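import Summits.ABC.IUTFork.Thm311RealInd1StripTwistPlanesJW
import Mathlib.Topology.Algebra.Module.FiniteDimension
import Mathlib.Analysis.Normed.Operator.Basic
import HarnessLib

/-!
# [IUTchIII] Thm 3.11 (i) (Ind1) at `v ∈ 𝕍^non`: the inflation of record in INDEX (log-volume) currency — the subgroup generated
# by a moved ball `𝔪_v^m` and its image has index `≥ p` over `𝔪_v^m`

PROOF-ONLY file (abc-iut cell, Cor. 3.12 sub-crew, seat abc-iut-c312-1 = holder of record of the typed [IUTchIII] Thm. 3.11,
gen 10; row «R11 IND1-STRIP-MOVER-ALL-PLANES», part h).  TAKES NO SIDE on [IUTchIII] Cor. 3.12.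

The windowed/outward movers (p481941, p482234) give, in every window of `e(v|p)+1` consecutive balls, a ball `B = 𝔪_v^m` and a realised
twist `T` with `T(B) ⊄ B`.  Here this is converted into the currency of log-volumes: the additive subgroup `B ⊔ T(B)` generated by `B`
and its image — the first step of the (Ind1)-hull of `B` — has INDEX AT LEAST `p` over `B` (so Haar measure `≥ p·μ(B)`, log-volume gain
`≥ log p` un-normalised):
* §1 `prime_le_relIndex_of_lt` — an intermediate subgroup `B < S ≤ B'` with `[B' : B] = p^N` has `p ≤ [S : B]`;
  `relIndex_piBall_zpow_add` — `[ϖ^m 𝒪 : ϖ^{m+n} 𝒪] = (#𝒪/𝔪)^n`;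
* §2 `exists_map_transvection_le_piBall` — a transvection `x ↦ x + c x • y` (`c` a `ℚ_p`-linear functional of the locally compact `K`,
  automatically continuous) maps every ball `ϖ^m 𝒪` into `ϖ^{m−n} 𝒪` for ONE `n` (all `m`);
  **`prime_le_relIndex_sup_map_of_not_mem`** — if moreover some `x ∈ ϖ^m 𝒪` has `x + c x • y ∉ ϖ^m 𝒪`, then
  `p ≤ [ϖ^m 𝒪 ⊔ T(ϖ^m 𝒪) : ϖ^m 𝒪]`;
* §3 **`exists_prime_le_relIndex_window_of_odd`** — with the all-planes hypotheses (`f` odd, `[K:ℚ_p] < e + 2#ι`): in every window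
  `k ≤ m ≤ k + e` some ball and some transvection of the family have this index `≥ p`;
* §4 AT THE REAL LOG-SHELL **`Real.exists_prime_le_relIndex_of_dehnTwistsAll_odd`** — assuming `DehnTwistTransvectionsOnUnitsAll`, at every
  `v ∣ p` odd with `f(v|p)` odd and `e(v|p) ≥ 3`, for every `k` some `χ ∈ Real.ind1StripOf v (Real.galoisLog v)` and `m ∈ [k, k+e(v|p)]` have
  `p ≤ [𝔪_v^m ⊔ χ(𝔪_v^m) : 𝔪_v^m]` (`K_v` in abc-iut-S7's rescaled norm; `χ` acting through the identity `of`).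
Classical; [claim: Mochizuki2012, status: disputed] for every [IUTchIII] quotation; [cite: NeukirchSchmidtWingberg2008, Thm 7.5.14];
[cite: Kondo2025OuterAutMLF, §2 Thm 2.1 and proof of Thm 2.3 p.10]; [cite: DupuyHilado2025, §4.7].  typed ≠ proved; a conditional
theorem discharges nothing it binds.
-/

set_option autoImplicit false

noncomputable section

open Metric Set

namespace Summit.ABC.IUTFork.Thm311.TwistLattice

open Literature.NumberTheory.GaloisRepresentations.Ultrametric Literature.IUT.LogVolume

/-! ## 1. Index bookkeeping -/

section Index

/-- **An intermediate subgroup of a `p`-power-index pair has index `≥ p` unless trivial**: `B < S ≤ B'`, `[B' : B] = p^N`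
`⟹ p ≤ [S : B]`. [folklore] -/
theorem prime_le_relIndex_of_lt {G : Type*} [AddGroup G] {B S B' : AddSubgroup G} (hBS : B < S) (hSB' : S ≤ B')
    {p N : ℕ} (hp : p.Prime) (hidx : B.relIndex B' = p ^ N) : p ≤ B.relIndex S := by
  have hdvd : B.relIndex S ∣ p ^ N := by
    rw [← hidx, ← AddSubgroup.relIndex_mul_relIndex B S B' hBS.le hSB']
    exact Dvd.intro _ rfl
  obtain ⟨k, -, hk⟩ := (Nat.dvd_prime_pow hp).mp hdvd
  have hne : B.relIndex S ≠ 1 := by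
    rw [Ne, AddSubgroup.relIndex_eq_one]
    exact fun h => (lt_irrefl B) (lt_of_lt_of_le hBS h)
  rw [hk] at hne ⊢
  rcases k with _ | k
  · exact absurd (pow_zero p) hne
  · exact Nat.le_self_pow (Nat.succ_ne_zero k) p

variable {K : Type*} [NontriviallyNormedField K] [IsUltrametricDist K]

/-- **`[ϖ^m 𝒪 : ϖ^{m+n} 𝒪] = (resIndex ϖ)^n`** (the ball chain, `‖ϖ‖ ≤ 1`). [folklore] -/
theorem relIndex_piBall_zpow_add {ϖ : Kˣ} (hϖ : ‖(ϖ : K)‖ ≤ 1) (m : ℤ) (n : ℕ) :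
    ((piBall (ϖ ^ (m + n)) : OpenAddSubgroup K).toAddSubgroup).relIndex
        (piBall (ϖ ^ m) : OpenAddSubgroup K).toAddSubgroup = resIndex ϖ ^ n := by
  have h := relIndex_chain_eq_prod (fun j : ℕ => (piBall (ϖ ^ (m + (j : ℤ))) : OpenAddSubgroup K).toAddSubgroup) n
    (fun j _ => by rw [Nat.cast_succ, ← add_assoc]; exact piBall_zpow_succ_le hϖ _)
  simp only [Nat.cast_zero, add_zero] at h
  rw [h, Finset.prod_congr rfl fun j _ => by rw [Nat.cast_succ, ← add_assoc, relIndex_piBall_zpow_succ], Finset.prod_const,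
    Finset.card_range]

end Index

/-! ## 2. A transvection maps balls into balls with a uniform loss; a moved ball generates an index-`≥ p` super-lattice -/

section Transvection

variable (p : ℕ) [Fact p.Prime] {K : Type*} [NontriviallyNormedField K] [NormedAlgebra ℚ_[p] K]
  [IsUltrametricDist K] [ProperSpace K]

/-- **Uniform loss of a transvection**: for a `ℚ_p`-linear functional `c` of the locally compact `K` (finite-dimensional over `ℚ_p`,
hence `c` continuous and bounded) and `y ∈ K`, there is `n ∈ ℕ` with `x + c x • y ∈ ϖ^{m−n} 𝒪` for every `m` and every
`x ∈ ϖ^m 𝒪`. [folklore] -/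
theorem exists_transvection_mem_piBall {ϖ : Kˣ} (hϖ : IsUniformizer ϖ) (c : K →ₗ[ℚ_[p]] ℚ_[p]) (y : K) :
    ∃ n : ℕ, ∀ (m : ℤ) (x : K), x ∈ (piBall (ϖ ^ m) : OpenAddSubgroup K).toAddSubgroup →
      x + c x • y ∈ (piBall (ϖ ^ (m - n)) : OpenAddSubgroup K).toAddSubgroup := by
  haveI : FiniteDimensional ℚ_[p] K := FiniteDimensional.of_locallyCompactSpace ℚ_[p]
  have hc : Continuous c := c.continuous_of_finiteDimensional
  obtain ⟨C, hC0, hC⟩ := (⟨c, hc⟩ : K →L[ℚ_[p]] ℚ_[p]).bound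
  have hϖ0 : 0 < ‖(ϖ : K)‖ := norm_pos_iff.mpr ϖ.ne_zero
  have hϖinv : 1 < ‖(ϖ : K)‖⁻¹ := one_lt_inv_iff₀.mpr ⟨hϖ0, hϖ.1⟩
  obtain ⟨n, hn⟩ := pow_unbounded_of_one_lt (max 1 (C * ‖y‖)) hϖinv
  refine ⟨n, fun m x hx => ?_⟩
  rw [mem_toAddSubgroup_piBall, Units.val_zpow_eq_zpow_val, norm_zpow] at hx ⊢
  have hbound : max 1 (C * ‖y‖) ≤ (‖(ϖ : K)‖ ^ (n : ℤ))⁻¹ := by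
    rw [zpow_natCast, ← inv_pow]; exact hn.le
  have hxn : ‖x‖ * max 1 (C * ‖y‖) ≤ ‖(ϖ : K)‖ ^ (m - n) := by
    rw [zpow_sub₀ hϖ0.ne', div_eq_mul_inv]
    exact mul_le_mul hx hbound (le_trans zero_le_one (le_max_left _ _)) (zpow_nonneg hϖ0.le _)
  refine (IsUltrametricDist.norm_add_le_max _ _).trans (max_le ?_ ?_)
  · calc ‖x‖ = ‖x‖ * 1 := (mul_one _).symm
      _ ≤ ‖x‖ * max 1 (C * ‖y‖) := mul_le_mul_of_nonneg_left (le_max_left _ _) (norm_nonneg _)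
      _ ≤ _ := hxn
  · calc ‖c x • y‖ = ‖c x‖ * ‖y‖ := norm_smul _ _
      _ ≤ C * ‖x‖ * ‖y‖ := mul_le_mul_of_nonneg_right (hC x) (norm_nonneg _)
      _ = ‖x‖ * (C * ‖y‖) := by ring
      _ ≤ ‖x‖ * max 1 (C * ‖y‖) := mul_le_mul_of_nonneg_left (le_max_right _ _) (norm_nonneg _)
      _ ≤ _ := hxn

open scoped NormedField in
/-- **A MOVED ball generates an index-`≥ p` super-lattice.**  Let `T : K →+ K` be the transvection `x ↦ x + c x • y` and suppose
some `x ∈ B = ϖ^m 𝒪` has `T x ∉ B`.  Then the subgroup `B ⊔ T(B)` satisfies `p ≤ [B ⊔ T(B) : B]` — it lies between `B` and a larger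
ball `ϖ^{m−n} 𝒪`, whose index over `B` is a power of `#(𝒪/𝔪) = p^f`. [folklore] -/
theorem prime_le_relIndex_sup_map_of_not_mem {ϖ : Kˣ} (hϖ : IsUniformizer ϖ) (c : K →ₗ[ℚ_[p]] ℚ_[p]) (y : K)
    (T : K →+ K) (hT : ∀ x, T x = x + c x • y) {m : ℤ} {x : K}
    (hx : x ∈ (piBall (ϖ ^ m) : OpenAddSubgroup K).toAddSubgroup)
    (hTx : T x ∉ (piBall (ϖ ^ m) : OpenAddSubgroup K).toAddSubgroup) :
    p ≤ ((piBall (ϖ ^ m) : OpenAddSubgroup K).toAddSubgroup).relIndex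
      ((piBall (ϖ ^ m) : OpenAddSubgroup K).toAddSubgroup ⊔ ((piBall (ϖ ^ m) : OpenAddSubgroup K).toAddSubgroup).map T) := by
  obtain ⟨n, hn⟩ := exists_transvection_mem_piBall p hϖ c y
  set B := (piBall (ϖ ^ m) : OpenAddSubgroup K).toAddSubgroup with hB
  -- `B < B ⊔ T(B) ≤ ϖ^{m-n} 𝒪`
  have hlt : B < B ⊔ B.map T :=
    lt_of_le_of_ne le_sup_left fun h => hTx (h.symm ▸ AddSubgroup.mem_sup_right ⟨x, hx, rfl⟩)
  have hle : B ⊔ B.map T ≤ (piBall (ϖ ^ (m - n)) : OpenAddSubgroup K).toAddSubgroup := by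
    refine sup_le ?_ ?_
    · intro z hz
      rw [hB, mem_toAddSubgroup_piBall] at hz
      rw [mem_toAddSubgroup_piBall]
      refine hz.trans ?_
      rw [Units.val_zpow_eq_zpow_val, Units.val_zpow_eq_zpow_val, norm_zpow, norm_zpow]
      exact (zpow_le_zpow_iff_right_of_lt_one₀ (norm_pos_iff.mpr ϖ.ne_zero) hϖ.1).mpr (by omega)
    · rintro _ ⟨z, hz, rfl⟩
      rw [hT]
      exact hn m z hz
  -- `[ϖ^{m-n} 𝒪 : B] = (p^f)^n`
  have hidx : B.relIndex (piBall (ϖ ^ (m - n)) : OpenAddSubgroup K).toAddSubgroup =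
      p ^ (residueDegree p K * n) := by
    have h := relIndex_piBall_zpow_add hϖ.1.le (m - n) n
    rw [sub_add_cancel] at h
    rw [hB, h, hϖ.resIndex_eq_card_residueField, card_residueField p K, ← pow_mul]
  exact prime_le_relIndex_of_lt hlt hle (Fact.out : p.Prime) hidx

end Transvection

/-! ## 3. With the all-planes hypotheses: an index-`≥ p` inflation in every window -/

section Window

variable (p : ℕ) [Fact p.Prime] {K : Type*} [NontriviallyNormedField K] [NormedAlgebra ℚ_[p] K]
  [IsUltrametricDist K] [ProperSpace K]

open scoped NormedField in
/-- **In every window of `e + 1` consecutive balls some ball is inflated with index `≥ p`** (`f` odd, `[K : ℚ_p] < e + 2#ι`,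
Kronecker family of twist planes; the transvections read as additive endomorphisms `T i, T' i` of `K`).
[cite: NeukirchSchmidtWingberg2008, Thm 7.5.14] [cite: Kondo2025OuterAutMLF, §2 Thm 2.1 and proof of Thm 2.3 p.10] -/
theorem exists_prime_le_relIndex_window_of_odd (hf : Odd (residueDegree p K))
    {ι : Type*} [Fintype ι] [DecidableEq ι]
    (hdim : Module.finrank ℚ_[p] K < absRamificationIdx p K + 2 * Fintype.card ι)
    {ϖ : Kˣ} (hϖ : IsUniformizer ϖ) {ca cb : ι → (K →ₗ[ℚ_[p]] ℚ_[p])} {ya yb : ι → K}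
    (haa : ∀ i j, ca i (ya j) = if i = j then 1 else 0) (hbb : ∀ i j, cb i (yb j) = if i = j then 1 else 0)
    (hab : ∀ i j, ca i (yb j) = 0) (hba : ∀ i j, cb i (ya j) = 0)
    (T T' : ι → (K →+ K)) (hT : ∀ i x, T i x = x + cb i x • ya i) (hT' : ∀ i x, T' i x = x - ca i x • yb i) (k : ℤ) :
    ∃ m : ℤ, k ≤ m ∧ m ≤ k + absRamificationIdx p K ∧ ∃ S : K →+ K, (S ∈ Set.range T ∨ S ∈ Set.range T') ∧
      p ≤ ((piBall (ϖ ^ m) : OpenAddSubgroup K).toAddSubgroup).relIndex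
        ((piBall (ϖ ^ m) : OpenAddSubgroup K).toAddSubgroup ⊔ ((piBall (ϖ ^ m) : OpenAddSubgroup K).toAddSubgroup).map S) := by
  obtain ⟨m, hkm, hmk, i, x, hx, hout⟩ := exists_transvection_mapsOut_piBall_of_odd p hf hdim hϖ haa hbb hab hba k
  have hball : ∀ z : K, z ∈ (piBall (ϖ ^ m) : OpenAddSubgroup K).toAddSubgroup ↔ ‖z‖ ≤ ‖(ϖ : K)‖ ^ m := by
    intro z
    rw [mem_toAddSubgroup_piBall, Units.val_zpow_eq_zpow_val, norm_zpow]
  refine ⟨m, hkm, hmk, ?_⟩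
  rcases hout with h | h
  · refine ⟨T i, Or.inl ⟨i, rfl⟩, prime_le_relIndex_sup_map_of_not_mem p hϖ (cb i) (ya i) (T i) (hT i) ((hball x).mpr hx) ?_⟩
    rw [hball, hT, not_le]; exact h
  · refine ⟨T' i, Or.inr ⟨i, rfl⟩,
      prime_le_relIndex_sup_map_of_not_mem p hϖ (-(ca i)) (yb i) (T' i) (fun z => ?_) ((hball x).mpr hx) ?_⟩
    · rw [hT', LinearMap.neg_apply, neg_smul, sub_eq_add_neg]
    · rw [hball, hT', not_le]; exact h

end Window

end Summit.ABC.IUTFork.Thm311.TwistLattice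

/-! ## 4. At the real log-shell `K_v`: index-`≥ p` inflation by print's (Ind1) strip part in every window -/

namespace Summit.ABC.IUTFork.Thm311.Real

open NumberField IsDedekindDomain Literature.NumberTheory.NumberFields Literature.IUT.LogVolume
open Literature.NumberTheory.GaloisRepresentations.Ultrametric Summit.ABC.IUTFork.Thm311.TwistLattice
open Literature.AnabelianGeometry.AbsoluteAnabelian

variable {F : Type} [Field F] [NumberField F] (v : HeightOneSpectrum (𝓞 F))

/-- **STATEMENT OF RECORD (index currency): at every `v ∣ p` odd with `f(v|p)` ODD and `e(v|p) ≥ 3`, modulo the Jannsen–Wingberg fact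
for all planes, every window of `e(v|p)+1` consecutive ideal-shaped regions contains one, `𝔪_v^m`, such that the subgroup generated by
`𝔪_v^m` and its image under some `χ ∈ Real.ind1StripOf v (Real.galoisLog v)` has index AT LEAST `p` over `𝔪_v^m`** (`K_v` in
abc-iut-S7's rescaled norm; `χ` read on it through the identity `of`, as the additive endomorphism `of ∘ χ ∘ of⁻¹`).  Haar-measure
reading: `μ(⟨𝔪_v^m ∪ χ𝔪_v^m⟩) ≥ p · μ(𝔪_v^m)`. [claim: Mochizuki2012, status: disputed]
[cite: Kondo2025OuterAutMLF, §2 Thm 2.1 and proof of Thm 2.3 p.10] [cite: DupuyHilado2025, §4.7] -/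
theorem exists_prime_le_relIndex_of_dehnTwistsAll_odd (hJW : DehnTwistTransvectionsOnUnitsAll)
    (p : ℕ) [Fact p.Prime] (hv : ((p : ℕ) : 𝓞 F) ∈ v.asIdeal) (hp2 : p ≠ 2)
    (hf : Odd (v.asIdeal.inertiaDeg ℤ)) (he : 3 ≤ v.asIdeal.ramificationIdx ℤ)
    {ϖ : (RescaledCompletion F p v hv)ˣ} (hϖ : IsUniformizer ϖ) (k : ℤ) :
    ∃ χ ∈ ind1StripOf v (galoisLog v), ∃ m : ℤ, k ≤ m ∧ m ≤ k + v.asIdeal.ramificationIdx ℤ ∧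
      p ≤ ((piBall (ϖ ^ m) : OpenAddSubgroup (RescaledCompletion F p v hv)).toAddSubgroup).relIndex
        ((piBall (ϖ ^ m) : OpenAddSubgroup (RescaledCompletion F p v hv)).toAddSubgroup ⊔
          ((piBall (ϖ ^ m) : OpenAddSubgroup (RescaledCompletion F p v hv)).toAddSubgroup).map
            (AddEquiv.toAddMonoidHom
              (((RescaledCompletion.of F p v hv).symm.toAddEquiv.trans
                (χ.trans (RescaledCompletion.of F p v hv).toAddEquiv))))) := by
  have h3 : 3 ≤ localDeg F v := by
    rw [localDeg]; exact he.trans (Nat.le_mul_of_pos_right _ hf.pos)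
  obtain ⟨c, g, hc, hcard, ca, cb, ya, yb, ψ, ψ', haa, hbb, hab, hba, hψ, hψ', hT, hT'⟩ :=
    exists_realised_planes_of_dehnTwistsAll v hJW p hv hp2 h3
  -- the invariants of `K_v` (abc-iut-S7)
  have hfK : Odd (residueDegree p (RescaledCompletion F p v hv)) := by
    rw [residueDegree_rescaledCompletion F p v hv]; exact hf
  have hfin : Module.finrank ℚ_[p] (RescaledCompletion F p v hv) = localDeg F v :=
    (RescaledCompletion.localDeg_eq_finrank F p v hv).symm
  have heK : absRamificationIdx p (RescaledCompletion F p v hv) = v.asIdeal.ramificationIdx ℤ :=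
    absRamificationIdx_rescaledCompletion F p v hv
  have hdim : Module.finrank ℚ_[p] (RescaledCompletion F p v hv) <
      absRamificationIdx p (RescaledCompletion F p v hv) + 2 * Fintype.card (Fin g) := by
    rw [heK, hfin, Fintype.card_fin]; omega
  -- the realised transvections as additive endomorphisms of `K_v` (rescaled)
  let conj : (v.adicCompletion F ≃+ v.adicCompletion F) → (RescaledCompletion F p v hv →+ RescaledCompletion F p v hv) :=
    fun χ => AddEquiv.toAddMonoidHom
      (((RescaledCompletion.of F p v hv).symm.toAddEquiv.trans (χ.trans (RescaledCompletion.of F p v hv).toAddEquiv)))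
  have hconj : ∀ χ x, conj χ x = RescaledCompletion.of F p v hv (χ ((RescaledCompletion.of F p v hv).symm x)) :=
    fun _ _ => rfl
  obtain ⟨m, hkm, hmk, S, hS, hidx⟩ := exists_prime_le_relIndex_window_of_odd p hfK hdim hϖ haa hbb hab hba
    (fun i => conj (ψ i)) (fun i => conj (ψ' i)) (fun i x => by rw [hconj, hT]) (fun i x => by rw [hconj, hT']) k
  rw [heK] at hmk
  rcases hS with ⟨i, rfl⟩ | ⟨i, rfl⟩
  · exact ⟨ψ i, hψ i, m, hkm, hmk, hidx⟩
  · exact ⟨ψ' i, hψ' i, m, hkm, hmk, hidx⟩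

end Summit.ABC.IUTFork.Thm311.Real

end
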